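import Mathlib
import HarnessLib

/-!
# `BlockEntropyBudget` — the static-to-dynamic transfer (abstract mechanism)

Helper file for the support item stmt-AtomisticToContinuum-14427 (`BlockEntropyBudget`, route
`SuperextensiveClosureCost`, sub-problem `HydrodynamicLimit`): the measure-theoretic skeleton of
the mechanism printed in the item —

> `dLG/dG = exp(N·Λ_N(U_N(0)))` with `Λ_N` a function of the time-`0` empirical fields, `G`
> flow-invariant, static block-level LD upper bound under `G`, totals conserved

— isolated as an abstract two-time inequality, so that a proof of the item reduces to its analytic
inputs (cell discretisation with `exp(o(N))` cells, the static cell large-deviation bound under the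
invariant Gibbs law, the tilt identity and the entropy comparison).

**Setting.** `G` is a measure on `Ω` preserved by a map `T : Ω → Ω` (one flow map `Φ.flow r`);
`π : Ω → K` is a measurable "macrostate" map into a type with measurable singletons (the block
cells); the non-equilibrium law `μ` is dominated by the tilted law `G.withDensity (w ∘ π)` whose
density depends on the time-`0` cell only.

* `tiltedCell_inter_le`: `G.withDensity (w ∘ π) (π⁻¹{a} ∩ s) ≤ w a · G (π⁻¹{a} ∩ s)`.
* `twoTimeCell_le_tilt_mul`: `μ (π⁻¹{a} ∩ T⁻¹ π⁻¹{b}) ≤ w a · G (π⁻¹{b})` (tilt at time `0`,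
  invariance moves the time-`r` cell back to time `0`).
* `measure_twoTime_rel_le_sum`: union bound over the finitely many pairs of cells.
* `measure_twoTime_rel_le_card_sq_mul`: if `w a · G(π⁻¹{b}) ≤ ε` whenever the pair `(a, b)` is in
  the "entropy went up by `δ`" relation `R`, then `μ {R (π ω) (π (T ω))} ≤ |K|² ε`.

With `|K| = exp(o(N))` cells, `w a ≤ exp(N Λ(a) − N P)`, `G(π⁻¹{b}) ≤ exp(−N I(b) + o(N))` and
`I(b) − I(a) ≥ S(b) − S(a) − o(1)` on pairs with equal conserved totals (other pairs having
`G`-null two-time cells), the right-hand side is `exp(−N δ + o(N)) → 0`: this is exactly the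
printed mechanism; none of the analytic inputs is proved here.

References: C. Kipnis, C. Landim, *Scaling Limits of Interacting Particle Systems* (1999), App. 1
§8 (entropy and large deviations under an invariant reference measure); W. De Roeck, C. Maes,
K. Netočný, *H-theorems from macroscopic autonomous equations*, J. Stat. Phys. 123 (2006),
Prop. 3.1 (Liouville counting: an invariant measure and a macrostate map give the second law at
macrostate resolution).
-/

noncomputable section

namespace Summit.AtomisticToContinuum.HydrodynamicLimit.Theorems

open MeasureTheory Set
open scoped ENNReal

variable {Ω K : Type*} [MeasurableSpace Ω] [MeasurableSpace K] [MeasurableSingletonClass K]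

/-- **Tilt on a time-`0` cell.** If the density of the tilted law depends on the cell `π ω` only,
then on the cell `π⁻¹{a}` it is the constant `w a`:
`G.withDensity (w ∘ π) (π⁻¹{a} ∩ s) = w a · G (π⁻¹{a} ∩ s)` for measurable `s`.
[cite: KipnisLandim1999, App. 1 §8] -/
theorem tiltedCell_inter_eq (G : Measure Ω) {π : Ω → K} (hπ : Measurable π) (w : K → ℝ≥0∞)
    (a : K) {s : Set Ω} (hs : MeasurableSet s) :
    G.withDensity (fun ω => w (π ω)) (π ⁻¹' {a} ∩ s) = w a * G (π ⁻¹' {a} ∩ s) := by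
  have hA : MeasurableSet (π ⁻¹' {a} ∩ s) := (hπ (measurableSet_singleton a)).inter hs
  rw [withDensity_apply _ hA]
  have hEq : EqOn (fun ω => w (π ω)) (fun _ => w a) (π ⁻¹' {a} ∩ s) := by
    intro ω hω
    have hωa : π ω = a := by simpa using hω.1
    simp [hωa]
  rw [setLIntegral_congr_fun hA hEq, setLIntegral_const]

/-- **Two-time cell bound (tilt at time `0`, invariance at time `r`).** If `μ ≤ G.withDensity (w ∘ π)`
and `T` preserves `G`, then for every pair of cells
`μ (π⁻¹{a} ∩ T⁻¹ π⁻¹{b}) ≤ w a · G (π⁻¹{b})`: the non-equilibrium probability of being in cell `a`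
at time `0` and in cell `b` at time `r` is at most the tilt of `a` times the STATIC `G`-probability
of `b`. [cite: KipnisLandim1999, App. 1 §8] -/
theorem twoTimeCell_le_tilt_mul (G μ : Measure Ω) {T : Ω → Ω} (hT : MeasurePreserving T G G)
    {π : Ω → K} (hπ : Measurable π) (w : K → ℝ≥0∞)
    (hμ : μ ≤ G.withDensity fun ω => w (π ω)) (a b : K) :
    μ (π ⁻¹' {a} ∩ T ⁻¹' (π ⁻¹' {b})) ≤ w a * G (π ⁻¹' {b}) := by
  have hb : MeasurableSet (π ⁻¹' {b}) := hπ (measurableSet_singleton b)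
  have hTb : MeasurableSet (T ⁻¹' (π ⁻¹' {b})) := hT.measurable hb
  calc μ (π ⁻¹' {a} ∩ T ⁻¹' (π ⁻¹' {b}))
      ≤ G.withDensity (fun ω => w (π ω)) (π ⁻¹' {a} ∩ T ⁻¹' (π ⁻¹' {b})) :=
        Measure.le_iff'.1 hμ _
    _ = w a * G (π ⁻¹' {a} ∩ T ⁻¹' (π ⁻¹' {b})) := tiltedCell_inter_eq G hπ w a hTb
    _ ≤ w a * G (T ⁻¹' (π ⁻¹' {b})) := by
        gcongr
        exact inter_subset_right
    _ = w a * G (π ⁻¹' {b}) := by rw [hT.measure_preimage hb.nullMeasurableSet]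

omit [MeasurableSpace K] [MeasurableSingletonClass K] in
/-- **Union bound over pairs of cells.** For a finite cell type, the event "the pair
(time-`0` cell, time-`r` cell) lies in the relation `R`" is covered by the two-time cells of the
pairs in `R`. [folklore] -/
theorem measure_twoTime_rel_le_sum [Fintype K] (μ : Measure Ω) (T : Ω → Ω) (π : Ω → K)
    (R : K → K → Prop) [∀ a b, Decidable (R a b)] :
    μ {ω | R (π ω) (π (T ω))} ≤
      ∑ p ∈ (Finset.univ.filter fun p : K × K => R p.1 p.2),
        μ (π ⁻¹' {p.1} ∩ T ⁻¹' (π ⁻¹' {p.2})) := by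
  classical
  set S : Finset (K × K) := Finset.univ.filter fun p : K × K => R p.1 p.2 with hS
  have hcover : {ω | R (π ω) (π (T ω))} ⊆
      ⋃ p ∈ S, (π ⁻¹' {p.1} ∩ T ⁻¹' (π ⁻¹' {p.2})) := by
    intro ω hω
    simp only [mem_setOf_eq] at hω
    simp only [mem_iUnion, mem_inter_iff, mem_preimage, mem_singleton_iff, exists_prop]
    exact ⟨(π ω, π (T ω)), by simp [hS, hω], rfl, rfl⟩
  exact (measure_mono hcover).trans (measure_biUnion_finset_le S _)

/-- **Static-to-dynamic transfer (the abstract block second law).** Let `T` preserve `G`, let the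
non-equilibrium law satisfy `μ ≤ G.withDensity (w ∘ π)` (tilt depending on the time-`0` cell only)
and suppose that for every pair of cells in the relation `R` ("mathematical entropy of `b` exceeds
that of `a` by `δ`") the tilt of `a` times the static `G`-probability of `b` is at most `ε`. Then
`μ {ω | R (π ω) (π (T ω))} ≤ |K|² · ε`. With `|K| = e^{o(N)}` cells and `ε = e^{−Nδ + o(N)}` this is
the printed mechanism of `BlockEntropyBudget`. [cite: KipnisLandim1999, App. 1 §8] -/
theorem measure_twoTime_rel_le_card_sq_mul [Fintype K] (G μ : Measure Ω) {T : Ω → Ω}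
    (hT : MeasurePreserving T G G) {π : Ω → K} (hπ : Measurable π) (w : K → ℝ≥0∞)
    (hμ : μ ≤ G.withDensity fun ω => w (π ω)) (R : K → K → Prop) (ε : ℝ≥0∞)
    (hR : ∀ a b, R a b → w a * G (π ⁻¹' {b}) ≤ ε) :
    μ {ω | R (π ω) (π (T ω))} ≤ (Fintype.card K : ℝ≥0∞) ^ 2 * ε := by
  classical
  refine (measure_twoTime_rel_le_sum μ T π R).trans ?_
  set S : Finset (K × K) := Finset.univ.filter fun p : K × K => R p.1 p.2 with hS
  calc ∑ p ∈ S, μ (π ⁻¹' {p.1} ∩ T ⁻¹' (π ⁻¹' {p.2}))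
      ≤ ∑ p ∈ S, ε := by
        refine Finset.sum_le_sum fun p hp => ?_
        have hRp : R p.1 p.2 := by simpa [hS] using hp
        exact (twoTimeCell_le_tilt_mul G μ hT hπ w hμ p.1 p.2).trans (hR p.1 p.2 hRp)
    _ = (S.card : ℝ≥0∞) * ε := by rw [Finset.sum_const, nsmul_eq_mul]
    _ ≤ (Fintype.card K : ℝ≥0∞) ^ 2 * ε := by
        gcongr
        have h1 : S.card ≤ (Finset.univ : Finset (K × K)).card := Finset.card_filter_le _ _
        rw [Finset.card_univ, Fintype.card_prod] at h1
        calc (S.card : ℝ≥0∞) ≤ ((Fintype.card K * Fintype.card K : ℕ) : ℝ≥0∞) := by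
              exact_mod_cast h1
          _ = (Fintype.card K : ℝ≥0∞) ^ 2 := by push_cast; ring

/-- **Transfer with an exceptional set.** Same as `measure_twoTime_rel_le_card_sq_mul`, but the
pairs are only required to satisfy the bound when the time-`0` cell lies in a set `A` of "good"
cells; the event that the time-`0` cell is bad is paid separately (under the non-equilibrium law
`μ` itself, where it is a time-`0`, i.e. static, event). [cite: KipnisLandim1999, App. 1 §8] -/
theorem measure_twoTime_rel_le_card_sq_mul_add [Fintype K] (G μ : Measure Ω) {T : Ω → Ω}
    (hT : MeasurePreserving T G G) {π : Ω → K} (hπ : Measurable π) (w : K → ℝ≥0∞)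
    (hμ : μ ≤ G.withDensity fun ω => w (π ω)) (R : K → K → Prop) (A : Set K) (ε : ℝ≥0∞)
    (hR : ∀ a ∈ A, ∀ b, R a b → w a * G (π ⁻¹' {b}) ≤ ε) :
    μ {ω | R (π ω) (π (T ω))} ≤ (Fintype.card K : ℝ≥0∞) ^ 2 * ε + μ (π ⁻¹' Aᶜ) := by
  classical
  have hsplit : {ω | R (π ω) (π (T ω))} ⊆
      {ω | π ω ∈ A ∧ R (π ω) (π (T ω))} ∪ π ⁻¹' Aᶜ := by
    intro ω hω
    by_cases hA : π ω ∈ A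
    · exact Or.inl ⟨hA, hω⟩
    · exact Or.inr hA
  refine (measure_mono hsplit).trans ((measure_union_le _ _).trans ?_)
  gcongr
  have := measure_twoTime_rel_le_card_sq_mul G μ hT hπ w hμ (fun a b => a ∈ A ∧ R a b) ε
    (fun a b hab => hR a hab.1 b hab.2)
  simpa using this

end Summit.AtomisticToContinuum.HydrodynamicLimit.Theorems

end
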